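import Mathlib

/-!
# The column-lift framework for `stub_tangencySets` (crux `LevelOneGL2Designs`,
stmt-MatrixMultiplication-14080) — wall-breaker axis 9 (random-algebraic constructions)

Every algebraic construction of large point–line induced matchings in `AG(2,p)` on record
(Szőnyi's Paley lift, Hunter–Pohoata–Verstraëte–Zhang's Ruzsa lift, arXiv:2601.19879 §2, and the
unions of translated parabolas searched by this axis) is a COLUMN LIFT: columns `a ∈ A ⊆ 𝔽_p`, a height
function `f`, a slope function `s`, column contents `T a ⊆ 𝔽_p`; the points are `(a, f a - t)`
(`t ∈ T a`) and the private line of `(a, f a - t)` is the line of slope `s a` through it.  The lift is a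
flag system of the stub's type as soon as

* (no wrap onto another point) `f a' - t' = f a - t + s a * (a' - a)` forces `a' = a` (and then `t' = t`),
  i.e. the "divergence" `Δ(a,a') = f a' - f a - s a (a' - a)` is never a difference `t - t'` of column
  entries — for `f = x²`, `s = 2x` this is `(a' - a)² ∉ T a - T a'`, the square-difference condition;
* (line avoids the origin) the intercept `f a - t - s a * a` is non-zero.

`columnLift_flags` proves exactly this, with `|S| = ∑_{a ∈ A} |T a|`.  It is the object this axis reduces
the stub to: the stub holds iff column data with `∑ |T a| ≥ c · p^{3/2}` exist for unboundedly many
primes; AXIS.md of the seat records why no such data are expected (Hanson–Petridis for `A = 𝔽_p`,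
Furstenberg–Sárközy for interval columns, HPVZ Conjecture 10.2 in general).

The normal-vector reduction `tangencyFlags_of_normals` of the companion file
`…StubTangencySetsCertified.lean` (p112497) is re-derived here as a private lemma so that this file
depends on Mathlib only.
-/

set_option linter.dupNamespace false

namespace Summit.MatrixMultiplication.MatrixMultiplication.Theorems.LevelOneGL2Designs.FlagLine

namespace TangencyCertified

open Finset Matrix

variable {p : ℕ} [Fact p.Prime]

/-- Private copy of the reduction `tangencyFlags_of_normals` (p112497): points with private lines
avoiding the origin, given by normal vectors, yield a flag system with `|S| = |P|`. -/
private theorem flags_of_normals_aux (P : Finset (Fin 2 → ZMod p))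
    (n : (Fin 2 → ZMod p) → (Fin 2 → ZMod p))
    (h0 : ∀ z ∈ P, z ⬝ᵥ n z ≠ 0)
    (huniq : ∀ z ∈ P, ∀ z' ∈ P, z' ⬝ᵥ n z = z ⬝ᵥ n z → z' = z) :
    ∃ S : Finset ((Fin 2 → ZMod p) × (Fin 2 → ZMod p)), S.card = P.card ∧
      ∀ g ∈ S, ∀ g' ∈ S, (dotProduct g.1 g'.2 = 1 ↔ g = g') := by
  classical
  refine ⟨P.image (fun z => (z, (z ⬝ᵥ n z)⁻¹ • n z)), ?_, ?_⟩
  · exact Finset.card_image_of_injective _ (fun z z' h => congrArg Prod.fst h)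
  · intro g hg g' hg'
    simp only [Finset.mem_image] at hg hg'
    obtain ⟨z, hz, rfl⟩ := hg
    obtain ⟨z', hz', rfl⟩ := hg'
    constructor
    · intro h
      have h' : z ⬝ᵥ n z' = z' ⬝ᵥ n z' := by
        rw [dotProduct_smul, smul_eq_mul] at h
        have hne := h0 z' hz'
        field_simp at h
        linear_combination h
      have hzz : z = z' := huniq z' hz' z hz h'
      subst hzz
      rfl
    · intro h
      have hzz : z = z' := congrArg Prod.fst h
      subst hzz
      rw [dotProduct_smul, smul_eq_mul, inv_mul_cancel₀ (h0 z hz)]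

/-- Membership in the point set of a column lift: `(a, f a - t)` for `a ∈ A`, `t ∈ T a`. -/
private theorem mem_columnPoints (A : Finset (ZMod p)) (f : ZMod p → ZMod p)
    (T : ZMod p → Finset (ZMod p)) (z : Fin 2 → ZMod p) :
    z ∈ A.biUnion (fun a => (T a).image fun t => ![a, f a - t]) ↔
      z 0 ∈ A ∧ f (z 0) - z 1 ∈ T (z 0) ∧ z = ![z 0, z 1] := by
  simp only [Finset.mem_biUnion, Finset.mem_image]
  constructor
  · rintro ⟨a, ha, t, ht, rfl⟩
    refine ⟨by simpa using ha, ?_, ?_⟩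
    · simpa using ht
    · ext i; fin_cases i <;> simp
  · rintro ⟨ha, ht, hz⟩
    refine ⟨z 0, ha, f (z 0) - z 1, ht, ?_⟩
    rw [hz]
    ext i; fin_cases i <;> simp

/-- **Column lift.**  Let `A ⊆ 𝔽_p` (columns), `f s : 𝔽_p → 𝔽_p` (heights and slopes) and column
contents `T a ⊆ 𝔽_p`.  Suppose
* `hΔ`: whenever `a, a' ∈ A`, `t ∈ T a`, `t' ∈ T a'` and `f a' - t' = f a - t + s a * (a' - a)` (the point
  `(a', f a' - t')` lies on the slope-`s a` line through `(a, f a - t)`), then `a' = a`;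
* `h0`: `f a - t - s a * a ≠ 0` for `a ∈ A`, `t ∈ T a` (that line misses the origin).
Then the points `(a, f a - t)` with their slope-`s a` lines (normal vector `(-s a, 1)`) form a flag
system of the type of `stub_tangencySets` with exactly `∑_{a ∈ A} |T a|` flags.  Szőnyi's Paley lift
(`A = 𝔽_p`, `f = -x²`, `s = -2x`, `T a = I ∖ {a²}` with `I` square-difference-free in `𝔽_p`) and the HPVZ
Ruzsa lift (interval columns, integer square-difference-free `T`) are the two instances in print.
[elementary] -/
theorem columnLift_flags (A : Finset (ZMod p)) (f s : ZMod p → ZMod p)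
    (T : ZMod p → Finset (ZMod p))
    (hΔ : ∀ a ∈ A, ∀ a' ∈ A, ∀ t ∈ T a, ∀ t' ∈ T a',
      f a' - t' = f a - t + s a * (a' - a) → a' = a)
    (h0 : ∀ a ∈ A, ∀ t ∈ T a, f a - t - s a * a ≠ 0) :
    ∃ S : Finset ((Fin 2 → ZMod p) × (Fin 2 → ZMod p)), S.card = ∑ a ∈ A, (T a).card ∧
      ∀ g ∈ S, ∀ g' ∈ S, (dotProduct g.1 g'.2 = 1 ↔ g = g') := by
  classical
  set P : Finset (Fin 2 → ZMod p) := A.biUnion (fun a => (T a).image fun t => ![a, f a - t]) with hP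
  have hcard : P.card = ∑ a ∈ A, (T a).card := by
    rw [hP, Finset.card_biUnion]
    · refine Finset.sum_congr rfl fun a _ => ?_
      rw [Finset.card_image_of_injective]
      intro t t' h
      have := congrFun h 1
      simpa using this
    · intro a _ a' _ hne
      rw [Function.onFun, Finset.disjoint_left]
      intro z hz hz'
      simp only [Finset.mem_image] at hz hz'
      obtain ⟨t, -, rfl⟩ := hz
      obtain ⟨t', -, h⟩ := hz'
      exact hne (by simpa using (congrFun h 0).symm)
  -- normal vector of the slope-`s a` line through a point of column `a = z 0`
  have h0' : ∀ z ∈ P, z ⬝ᵥ ![-s (z 0), 1] ≠ 0 := by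
    intro z hz
    rw [mem_columnPoints] at hz
    obtain ⟨ha, ht, hz⟩ := hz
    have key := h0 (z 0) ha (f (z 0) - z 1) ht
    rw [hz]
    simp only [dotProduct, Fin.sum_univ_two, Matrix.cons_val_zero, Matrix.cons_val_one]
    intro h
    apply key
    linear_combination h
  have huniq' : ∀ z ∈ P, ∀ z' ∈ P, z' ⬝ᵥ ![-s (z 0), 1] = z ⬝ᵥ ![-s (z 0), 1] → z' = z := by
    -- a second point of `P` on the line sits in the same column (by `hΔ`), hence is the same point
    intro z hz z' hz' h
    rw [mem_columnPoints] at hz hz'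
    obtain ⟨ha, ht, hzz⟩ := hz
    obtain ⟨ha', ht', hzz'⟩ := hz'
    simp only [dotProduct, Fin.sum_univ_two, Matrix.cons_val_zero, Matrix.cons_val_one] at h
    have hcol : z' 0 = z 0 := by
      refine hΔ (z 0) ha (z' 0) ha' (f (z 0) - z 1) ht (f (z' 0) - z' 1) ht' ?_
      linear_combination h
    have h1 : z' 1 = z 1 := by
      rw [hcol] at h
      linear_combination h
    rw [hzz, hzz', hcol, h1]
  obtain ⟨S, hS, hdes⟩ := flags_of_normals_aux P (fun z => ![-s (z 0), 1]) h0' huniq'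
  exact ⟨S, hS.trans hcard, hdes⟩

/-- The Paley lift in column form, as an instance of `columnLift_flags`: for `I ⊆ 𝔽_p` with no two
elements differing by a non-zero square, the points `(a, -a² - t)` (`a ∈ 𝔽_p`, `t ∈ I ∖ {a²}`, which
removes exactly the lines through the origin) with the slope-`(-2a)` lines form a flag system with
exactly `∑_a |I ∖ {a²}|` (`≥ p·|I| - p`) flags.  (Same object as `TangencyPaley.paley_lift` of seat k4,
HPVZ arXiv:2601.19879 Prop. 2.1; recorded to certify that the framework's hypotheses are the
square-difference condition on the nose.) [elementary] -/
theorem columnLift_paley (I : Finset (ZMod p))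
    (hI : ∀ a ∈ I, ∀ b ∈ I, ∀ z : ZMod p, a - b = z ^ 2 → z = 0) :
    ∃ S : Finset ((Fin 2 → ZMod p) × (Fin 2 → ZMod p)),
      S.card = ∑ a : ZMod p, (I.erase (a ^ 2)).card ∧
      ∀ g ∈ S, ∀ g' ∈ S, (dotProduct g.1 g'.2 = 1 ↔ g = g') := by
  classical
  refine columnLift_flags (p := p) Finset.univ (fun a => -a ^ 2) (fun a => -2 * a)
    (fun a => I.erase (a ^ 2)) ?_ ?_
  · intro a _ a' _ t ht t' ht' h
    have hsq : t - t' = (a' - a) ^ 2 := by linear_combination h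
    have := hI t (Finset.mem_of_mem_erase ht) t' (Finset.mem_of_mem_erase ht') (a' - a) hsq
    linear_combination this
  · intro a _ t ht h
    have : t = a ^ 2 := by linear_combination -h
    exact (Finset.mem_erase.mp ht).1 this

end TangencyCertified

end Summit.MatrixMultiplication.MatrixMultiplication.Theorems.LevelOneGL2Designs.FlagLine
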